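import Summits.AtomisticToContinuum.BoseEinsteinCondensation.Theses.BECInsertionCorrector
import Summits.AtomisticToContinuum.BoseEinsteinCondensation.Theorems.StaticResponseBound.Negative.Basic
import Literature.MathematicalPhysics.QuantumManyBody.WeightedCorrector
import Literature.MathematicalPhysics.QuantumManyBody.LangevinGenerator
import Literature.MathematicalPhysics.QuantumManyBody.PeriodicBoseGasScatteringODE
import Literature.MathematicalPhysics.QuantumManyBody.HardCoreScatteringLength
import Literature.MathematicalPhysics.QuantumManyBody.PeriodicBoseGasKineticMultiplierProofs
import Summits.AtomisticToContinuum.BoseEinsteinCondensation.Theorems.StaticResponseBound.Negative.UvThomsonFlowPotential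
import HarnessLib

/-!
# The infrared window of crux `BECInsertionCorrector.StaticResponseBound` (stmt-AtomisticToContinuum-12057):
# degeneracy audit of stub `stub_infraredHalf` (S1) of line `uv-thomson-force-wave`

S1 is the INFRARED (phonon + crossover) HALF of the crux: for every admissible `v` and every window
parameter `M₀ > 0` there are `ρ₀, C > 0` with the crux's inner inequality `Negative.Ineq v C ρ N k t Ψ`
(`E₀^per(N,L) − C t² N / max(ρa, |p|²) ≤ E_v(Ψ) + t⟨∑ⱼcos(p·xⱼ)⟩_Ψ`) for all `0 < ρ < ρ₀`, all
`N ≥ 1`, all `k ≠ 0` with `|p|² ≤ M₀² ρa`, all `t` and all finite-energy `Ψ` (`L = (N/ρ)^{1/3}`,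
`|p|² = psq L k = (2π/L)²∑kᵢ²`, `a = (scatteringLength v).toReal`).  It is VERBATIM (`PhononBody`
inlined) the statement `StaticResponseBoundPhonon` delivered by the sibling skeleton
`Cruxes/StaticResponseBound/Lines/stable-fraction-square-completion.lean` from its open stubs A (softened-mode
hyperuniformity, 9093-class) + B (Landau sector floor for all `N`, = stmt-AtomisticToContinuum-9091
`LandauSectorBound` class) + C; none of these, and no theorem implying S1, is in the tree
(`Theorems/StaticResponseBound/` holds only `Negative/Basic`, `Negative/CellToolkit`; the only landed
sector floor is the c.o.m. bound `ofReal_norm_sq_div_le_momentumSectorEnergy`, `|q|²/N`, useless here).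
This file does NOT prove S1; it records, sorry-free, the LOOPHOLE / DEGENERACY AUDIT of the
signature as typed (helper material for the crux item, `--supports`):

* §1 window algebra.  `∑kᵢ² ≥ 1` and `|p|² ≥ (2π/L)² > 0` for `k ≠ 0` (`BoseGas.one_le_sum_sq_of_ne_zero`,
  `sq_div_le_psq`, `Negative.UvThomsonFlow.psq_pos`, both reused from the tree); inside the window `(2π)² ≤ M₀²(ρa)L²` (the box is at least
  `2π/M₀` healing lengths `(ρa)^{-1/2}` wide, `window_sideLength_sq`) and, cubing with `L³ = N/ρ`, the
  exact condition `|p|² ≤ M₀²ρa ⟺ (2π)⁶(∑kᵢ²)³ ≤ M₀⁶·(ρa³)·N²` (`window_iff`), in particular the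
  threshold `N ≥ (2π/M₀)³(ρa³)^{-1/2}` (`window_threshold`).  Hence
  `a > 0` in the window (`scatteringLength_toReal_pos_of_window`) and, for every `N₀`, the window is
  EMPTY for all `N ≤ N₀` once `ρ·(M₀⁶a³N₀²) < (2π)⁶` (`lt_psq_of_le`, `infraredHalf_vacuous_of_le`):
  every bounded-`N` fragment of S1 is vacuous — S1 is a pure thermodynamic-limit statement
  (`N → ∞` along `L = (N/ρ)^{1/3}`), not reachable by any fixed-`N` computation.
* §2 the vacuous sub-case `a.toReal = 0` (window `|p|² ≤ 0` empty):
  `infraredHalf_of_scatteringLength_toReal_eq_zero`; instance `v = 0` (`infraredHalf_zero`).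
* §3 no `⊤`-junk in `a`: on the admissible class `a ≠ ⊤` (tree:
  `IsRepulsiveFiniteRange.scatteringLength_ne_top`, `scatteringLength_le_of_range`), so
  `a.toReal = 0 ↔ a = 0` (`scatteringLength_toReal_eq_zero_iff`) and `0 ≤ a.toReal ≤ max R₀ 0`
  (`scatteringLength_toReal_le_max_range`).  `a = 0` happens exactly for the Lebesgue-trivial
  potentials (e.g. `v = 0`, or `v = ⊤` on a null set of radii), for which the whole crux sits on the
  kinetic branch.
* §4 no denominator junk: in the window `0 < |p|² ≤ max(ρa,|p|²) ≤ max(1,M₀²)·ρa` (`max_window_bounds`),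
  so `x/0`-junk never occurs and the crux's constant there is COMPRESSIBILITY-limited (`∝ N/(ρa)`); the
  certified trivial regimes of `Negative/Basic` specialise to `t = 0` (`Negative.ineq_zero`, an instance)
  and `|t| ≥ max(1,M₀²)ρa/C` (`ineq_of_window_large_t`).  OPEN REMAINDER of S1:
  `0 < |t| < max(1,M₀²)ρa/C` at `N ≥ (2π/M₀)³(ρa³)^{-1/2}`, interacting (`a > 0`).
* §5 dictionary (both directions, constants `× max(1,M₀²)`): on the window, S1's `∀ t` family is
  EQUIVALENT to the all-states compressibility bound `⟨∑cos⟩_Ψ² ≤ 4C′N(E_Ψ − E₀)/(ρa)`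
  (`ineq_of_compressibility`, `compressibility_of_forall_ineq`, `infraredHalf_of_compressibility`) —
  the static-structure / susceptibility statement `χ_N(p) ≤ C′N/(ρa)` uniformly in `N`, whose rigorous
  momentum-dependent UPPER bounds are the acknowledged open part of the Pitaevskii–Stringari programme
  (barrier `PitaevskiiStringariOneDimension`, scope_caveats).

No counterexample and no typing defect was found: the signature is consistent with `Negative.ineq_zero`,
`ineq_N_zero` (excluded here by `0 < N`), `ineq_of_large_t`, with the tightness `C ≥ 1/2` of
`Cruxes/StaticResponseBound/Disproof.lean` §C (its `N = 1` witness lies OUTSIDE the window once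
`ρa³ < (2π/M₀)⁶`, §1), and with Bogoliubov's `χ = N/(2(p² + 16πρa)) ≤ N/(2max(ρa,p²))`.
-/

noncomputable section

namespace Summit.AtomisticToContinuum.BoseEinsteinCondensation.Cruxes.StaticResponseBound.UvThomsonForceWave

open MeasureTheory Filter
open scoped ENNReal NNReal BigOperators
open Literature.MathematicalPhysics.QuantumManyBody.BoseGas
open Summit.AtomisticToContinuum.BoseEinsteinCondensation.Theses.BECInsertionCorrector
open Summit.AtomisticToContinuum.BoseEinsteinCondensation.Theorems.StaticResponseBound.Negative

/-! ## §1  Window algebra: `|p|² ≥ (2π/L)²`, the threshold `N ≥ (2π/M₀)³(ρa³)^{-1/2}` -/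

/-- `|p|² ≥ (2π/L)²` for `k ≠ 0`: the smallest nonzero lattice momentum. [folklore] -/
theorem sq_div_le_psq (L : ℝ) {k : Fin 3 → ℤ} (hk : k ≠ 0) : (2 * Real.pi / L) ^ 2 ≤ psq L k :=
  le_mul_of_one_le_right (sq_nonneg _) (one_le_sum_sq_of_ne_zero hk)

/-- Inside the window `|p|² ≤ M₀²ρa` the box is at least `2π/M₀` healing lengths wide:
`(2π)² ≤ M₀² (ρa) L²`, `L = (N/ρ)^{1/3}`. [folklore] -/
theorem window_sideLength_sq {v : ℝ → ℝ≥0∞} {M₀ ρ : ℝ} (hρ : 0 < ρ) {N : ℕ} (hN : 0 < N)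
    {k : Fin 3 → ℤ} (hk : k ≠ 0)
    (hwin : psq (sideLength ρ N) k ≤ M₀ ^ 2 * (ρ * (scatteringLength v).toReal)) :
    (2 * Real.pi) ^ 2 ≤ M₀ ^ 2 * (ρ * (scatteringLength v).toReal) * sideLength ρ N ^ 2 := by
  have hL : 0 < sideLength ρ N := sideLength_pos hρ hN
  have h1 : (2 * Real.pi / sideLength ρ N) ^ 2 ≤ M₀ ^ 2 * (ρ * (scatteringLength v).toReal) :=
    (sq_div_le_psq _ hk).trans hwin
  rwa [div_pow, div_le_iff₀ (by positivity)] at h1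

/-- **Window threshold.** Inside the window `|p|² ≤ M₀²ρa` (`N ≥ 1`, `k ≠ 0`) one has
`(2π)⁶ ≤ M₀⁶ · (ρ a³) · N²`, i.e. `N ≥ (2π/M₀)³ (ρa³)^{-1/2}`: the window contains only
thermodynamically large particle numbers (cube `window_sideLength_sq`, `L³ = N/ρ`). [folklore] -/
theorem window_threshold {v : ℝ → ℝ≥0∞} {M₀ ρ : ℝ} (hρ : 0 < ρ) {N : ℕ} (hN : 0 < N)
    {k : Fin 3 → ℤ} (hk : k ≠ 0)
    (hwin : psq (sideLength ρ N) k ≤ M₀ ^ 2 * (ρ * (scatteringLength v).toReal)) :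
    (2 * Real.pi) ^ 6 ≤ M₀ ^ 6 * (ρ * (scatteringLength v).toReal ^ 3) * (N : ℝ) ^ 2 := by
  set L := sideLength ρ N with hLdef
  set a := (scatteringLength v).toReal with hadef
  have hL3 : L ^ 3 = N / ρ := sideLength_pow_three hρ N
  have h2 : (2 * Real.pi) ^ 2 ≤ M₀ ^ 2 * (ρ * a) * L ^ 2 := window_sideLength_sq hρ hN hk hwin
  have h3 : ((2 * Real.pi) ^ 2) ^ 3 ≤ (M₀ ^ 2 * (ρ * a) * L ^ 2) ^ 3 := by gcongr
  have hL6 : (L ^ 2) ^ 3 = ((N : ℝ) / ρ) ^ 2 := by rw [← hL3]; ring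
  calc (2 * Real.pi) ^ 6 = ((2 * Real.pi) ^ 2) ^ 3 := by ring
    _ ≤ (M₀ ^ 2 * (ρ * a) * L ^ 2) ^ 3 := h3
    _ = M₀ ^ 6 * (ρ * a) ^ 3 * (L ^ 2) ^ 3 := by ring
    _ = M₀ ^ 6 * (ρ * a) ^ 3 * ((N : ℝ) / ρ) ^ 2 := by rw [hL6]
    _ = M₀ ^ 6 * (ρ * a ^ 3) * (N : ℝ) ^ 2 := by field_simp

/-- **The exact window condition.** For `N ≥ 1`, `ρ > 0` and any `k`, `M₀`:
`|p|² ≤ M₀²ρa ⟺ (2π)⁶ (∑ᵢkᵢ²)³ ≤ M₀⁶ (ρa³) N²`, i.e. the infrared window consists exactly of the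
pairs `(N, k)` with `N ≥ (2π|k|/M₀)³ (ρa³)^{-1/2}` (`L² = (N/ρ)^{2/3}`, cubing is monotone). [folklore] -/
theorem window_iff {v : ℝ → ℝ≥0∞} (M₀ : ℝ) {ρ : ℝ} (hρ : 0 < ρ) {N : ℕ} (hN : 0 < N)
    (k : Fin 3 → ℤ) :
    psq (sideLength ρ N) k ≤ M₀ ^ 2 * (ρ * (scatteringLength v).toReal) ↔
      (2 * Real.pi) ^ 6 * (∑ i, (k i : ℝ) ^ 2) ^ 3 ≤
        M₀ ^ 6 * (ρ * (scatteringLength v).toReal ^ 3) * (N : ℝ) ^ 2 := by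
  have hL : 0 < sideLength ρ N := sideLength_pos hρ hN
  have hL3 : sideLength ρ N ^ 3 = N / ρ := sideLength_pow_three hρ N
  have hM : 0 ≤ M₀ ^ 2 := sq_nonneg _
  have ha : 0 ≤ ρ * (scatteringLength v).toReal := mul_nonneg hρ.le ENNReal.toReal_nonneg
  have hS : 0 ≤ ∑ i, (k i : ℝ) ^ 2 := Finset.sum_nonneg fun i _ => sq_nonneg _
  have step1 : psq (sideLength ρ N) k ≤ M₀ ^ 2 * (ρ * (scatteringLength v).toReal) ↔
      (2 * Real.pi) ^ 2 * ∑ i, (k i : ℝ) ^ 2 ≤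
        M₀ ^ 2 * (ρ * (scatteringLength v).toReal) * sideLength ρ N ^ 2 := by
    unfold psq
    rw [div_pow, div_mul_eq_mul_div, div_le_iff₀ (by positivity)]
  have step2 : (2 * Real.pi) ^ 2 * ∑ i, (k i : ℝ) ^ 2 ≤
        M₀ ^ 2 * (ρ * (scatteringLength v).toReal) * sideLength ρ N ^ 2 ↔
      ((2 * Real.pi) ^ 2 * ∑ i, (k i : ℝ) ^ 2) ^ 3 ≤
        (M₀ ^ 2 * (ρ * (scatteringLength v).toReal) * sideLength ρ N ^ 2) ^ 3 :=
    (pow_le_pow_iff_left₀ (by positivity) (by positivity) three_ne_zero).symm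
  have hL6 : (sideLength ρ N ^ 2) ^ 3 = ((N : ℝ) / ρ) ^ 2 := by rw [← hL3]; ring
  have hr : (M₀ ^ 2 * (ρ * (scatteringLength v).toReal) * sideLength ρ N ^ 2) ^ 3 =
      M₀ ^ 6 * (ρ * (scatteringLength v).toReal ^ 3) * (N : ℝ) ^ 2 := by
    calc (M₀ ^ 2 * (ρ * (scatteringLength v).toReal) * sideLength ρ N ^ 2) ^ 3
        = M₀ ^ 6 * (ρ * (scatteringLength v).toReal) ^ 3 * (sideLength ρ N ^ 2) ^ 3 := by ring
      _ = M₀ ^ 6 * (ρ * (scatteringLength v).toReal) ^ 3 * ((N : ℝ) / ρ) ^ 2 := by rw [hL6]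
      _ = M₀ ^ 6 * (ρ * (scatteringLength v).toReal ^ 3) * (N : ℝ) ^ 2 := by field_simp
  rw [step1, step2, hr,
    show ((2 * Real.pi) ^ 2 * ∑ i, (k i : ℝ) ^ 2) ^ 3 = (2 * Real.pi) ^ 6 * (∑ i, (k i : ℝ) ^ 2) ^ 3
      by ring]

/-- In the window the scattering length is a positive real: `0 < a.toReal` (so `v` is not
Lebesgue-trivial and `a ≠ ⊤`). [folklore] -/
theorem scatteringLength_toReal_pos_of_window {v : ℝ → ℝ≥0∞} {M₀ ρ : ℝ} (hρ : 0 < ρ) {N : ℕ}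
    (hN : 0 < N) {k : Fin 3 → ℤ} (hk : k ≠ 0)
    (hwin : psq (sideLength ρ N) k ≤ M₀ ^ 2 * (ρ * (scatteringLength v).toReal)) :
    0 < (scatteringLength v).toReal := by
  have h := window_threshold hρ hN hk hwin
  by_contra ha
  have ha0 : (scatteringLength v).toReal = 0 := le_antisymm (not_lt.mp ha) ENNReal.toReal_nonneg
  have h0 : M₀ ^ 6 * (ρ * (scatteringLength v).toReal ^ 3) * (N : ℝ) ^ 2 = 0 := by
    rw [ha0]; ring
  have hpos : (0 : ℝ) < (2 * Real.pi) ^ 6 := by positivity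
  linarith

/-- **Below the threshold the window is empty**: if `N ≤ N₀` and `ρ · (M₀⁶ a³ N₀²) < (2π)⁶` then
`|p|² > M₀²ρa` for every `k ≠ 0`. [folklore] -/
theorem lt_psq_of_le {v : ℝ → ℝ≥0∞} {M₀ ρ : ℝ} (hρ : 0 < ρ) {N N₀ : ℕ} (hN : 0 < N)
    (hNN₀ : N ≤ N₀) {k : Fin 3 → ℤ} (hk : k ≠ 0)
    (hsmall : ρ * (M₀ ^ 6 * (scatteringLength v).toReal ^ 3 * (N₀ : ℝ) ^ 2) < (2 * Real.pi) ^ 6) :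
    M₀ ^ 2 * (ρ * (scatteringLength v).toReal) < psq (sideLength ρ N) k := by
  by_contra hwin
  have h := window_threshold hρ hN hk (not_lt.mp hwin)
  have hNN : (N : ℝ) ^ 2 ≤ (N₀ : ℝ) ^ 2 := by
    have : (N : ℝ) ≤ N₀ := by exact_mod_cast hNN₀
    gcongr
  have hc : 0 ≤ M₀ ^ 6 * (ρ * (scatteringLength v).toReal ^ 3) := by
    have : 0 ≤ M₀ ^ 6 := by positivity
    have : 0 ≤ (scatteringLength v).toReal ^ 3 := by positivity
    positivity
  have h' : M₀ ^ 6 * (ρ * (scatteringLength v).toReal ^ 3) * (N : ℝ) ^ 2 ≤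
      ρ * (M₀ ^ 6 * (scatteringLength v).toReal ^ 3 * (N₀ : ℝ) ^ 2) := by
    calc M₀ ^ 6 * (ρ * (scatteringLength v).toReal ^ 3) * (N : ℝ) ^ 2
        ≤ M₀ ^ 6 * (ρ * (scatteringLength v).toReal ^ 3) * (N₀ : ℝ) ^ 2 :=
          mul_le_mul_of_nonneg_left hNN hc
      _ = ρ * (M₀ ^ 6 * (scatteringLength v).toReal ^ 3 * (N₀ : ℝ) ^ 2) := by ring
  linarith

/-- **Every bounded-`N` fragment of S1 is vacuous.** For every `v`, `M₀`, `N₀` there is `ρ₁ > 0`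
(`ρ₁ = (2π)⁶/(M₀⁶a³N₀² + 1)`) below which the infrared window contains no `N ≤ N₀`, so the body
of S1 restricted to `N ≤ N₀` holds with ANY constant `C` and without the finite-energy guard: S1
is a pure thermodynamic-limit statement. [folklore] -/
theorem infraredHalf_vacuous_of_le (v : ℝ → ℝ≥0∞) (M₀ : ℝ) (N₀ : ℕ) :
    ∃ ρ₁ : ℝ, 0 < ρ₁ ∧ ∀ C : ℝ, ∀ ρ : ℝ, 0 < ρ → ρ < ρ₁ → ∀ N : ℕ, 0 < N → N ≤ N₀ →
      ∀ k : Fin 3 → ℤ, k ≠ 0 →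
        psq (sideLength ρ N) k ≤ M₀ ^ 2 * (ρ * (scatteringLength v).toReal) →
        ∀ t : ℝ, ∀ Ψ : PeriodicTrialState N (sideLength ρ N), Ineq v C ρ N k t Ψ := by
  set B : ℝ := M₀ ^ 6 * (scatteringLength v).toReal ^ 3 * (N₀ : ℝ) ^ 2 with hB
  have hB0 : 0 ≤ B := by
    have : 0 ≤ M₀ ^ 6 := by positivity
    have : 0 ≤ (scatteringLength v).toReal ^ 3 := by positivity
    positivity
  have h2π : (0 : ℝ) < (2 * Real.pi) ^ 6 := by positivity
  refine ⟨(2 * Real.pi) ^ 6 / (B + 1), by positivity, ?_⟩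
  intro C ρ hρ hρ₁ N hN hNN₀ k hk hwin t Ψ
  have hsmall : ρ * B < (2 * Real.pi) ^ 6 := by
    have h1 : ρ * B ≤ ρ * (B + 1) := by nlinarith
    have h2 : ρ * (B + 1) < (2 * Real.pi) ^ 6 / (B + 1) * (B + 1) :=
      mul_lt_mul_of_pos_right hρ₁ (by positivity)
    rw [div_mul_cancel₀ _ (by positivity)] at h2
    linarith
  exact absurd hwin (not_le.mpr (lt_psq_of_le hρ hN hNN₀ hk hsmall))

/-! ## §2  The vacuous sub-case `a.toReal = 0` -/

/-- **S1 for Lebesgue-trivial interactions.** If `(scatteringLength v).toReal = 0` (e.g. `v = 0`,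
or `a = ⊤`, which §3 excludes on the admissible class) the window `|p|² ≤ M₀²·ρ·0 = 0` is empty
(`|p|² > 0` for `k ≠ 0`, `N ≥ 1`), so the body of S1 holds vacuously, with `ρ₀ = C = 1`. [folklore] -/
theorem infraredHalf_of_scatteringLength_toReal_eq_zero (v : ℝ → ℝ≥0∞)
    (ha : (scatteringLength v).toReal = 0) (M₀ : ℝ) :
    ∃ ρ₀ : ℝ, 0 < ρ₀ ∧ ∃ C : ℝ, 0 < C ∧
      ∀ ρ : ℝ, 0 < ρ → ρ < ρ₀ → ∀ N : ℕ, 0 < N → ∀ k : Fin 3 → ℤ, k ≠ 0 →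
        psq (sideLength ρ N) k ≤ M₀ ^ 2 * (ρ * (scatteringLength v).toReal) →
        ∀ t : ℝ, ∀ Ψ : PeriodicTrialState N (sideLength ρ N), periodicEnergy v Ψ ≠ ⊤ →
          Ineq v C ρ N k t Ψ := by
  refine ⟨1, one_pos, 1, one_pos, ?_⟩
  intro ρ hρ _ N hN k hk hwin t Ψ _
  refine absurd hwin (not_le.mpr ?_)
  rw [ha, mul_zero, mul_zero]
  exact UvThomsonFlow.psq_pos (sideLength_pos hρ hN).ne' hk

/-- Instance `v = 0` (the free gas, `a(0) = 0`): S1 holds vacuously for every `M₀`. [folklore] -/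
theorem infraredHalf_zero (M₀ : ℝ) :
    ∃ ρ₀ : ℝ, 0 < ρ₀ ∧ ∃ C : ℝ, 0 < C ∧
      ∀ ρ : ℝ, 0 < ρ → ρ < ρ₀ → ∀ N : ℕ, 0 < N → ∀ k : Fin 3 → ℤ, k ≠ 0 →
        psq (sideLength ρ N) k ≤ M₀ ^ 2 * (ρ * (scatteringLength 0).toReal) →
        ∀ t : ℝ, ∀ Ψ : PeriodicTrialState N (sideLength ρ N), periodicEnergy 0 Ψ ≠ ⊤ →
          Ineq 0 C ρ N k t Ψ :=
  infraredHalf_of_scatteringLength_toReal_eq_zero 0 (by rw [scatteringLength_zero]; rfl) M₀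

/-! ## §3  No `⊤`-junk in the scattering length on the admissible class -/

/-- On the admissible class `a ≠ ⊤` (finite range; tree `IsRepulsiveFiniteRange.scatteringLength_ne_top`),
hence `a.toReal = 0 ↔ a = 0`: the vacuous sub-case §2 is exactly `a = 0`. [folklore] -/
theorem scatteringLength_toReal_eq_zero_iff {v : ℝ → ℝ≥0∞} (hv : IsRepulsiveFiniteRange v) :
    (scatteringLength v).toReal = 0 ↔ scatteringLength v = 0 := by
  rw [ENNReal.toReal_eq_zero_iff, or_iff_left hv.scatteringLength_ne_top]

/-- On the admissible class `0 ≤ a.toReal ≤ max R₀ 0` for any range `R₀` of `v` (tree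
`scatteringLength_le_of_range`; hard core of radius `R`: `a = R`, `scatteringLength_hardCorePotential`).
[folklore] -/
theorem scatteringLength_toReal_le_max_range {v : ℝ → ℝ≥0∞} {R₀ : ℝ}
    (hR₀ : ∀ r, R₀ < r → v r = 0) : (scatteringLength v).toReal ≤ max R₀ 0 :=
  scatteringLength_le_of_range (le_max_right _ _) fun r hr => hR₀ r ((le_max_left _ _).trans_lt hr)

/-! ## §4  No denominator junk; the certified trivial regimes inside the window -/

/-- In the window: `0 < max(ρa,|p|²)` and `max(ρa,|p|²) ≤ max(1,M₀²)·ρa` — no `x/0` junk, and the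
crux's denominator is the compressibility scale `ρa` up to the factor `max(1,M₀²)`. [folklore] -/
theorem max_window_bounds {v : ℝ → ℝ≥0∞} {M₀ ρ : ℝ} (hρ : 0 < ρ) {N : ℕ} (hN : 0 < N)
    {k : Fin 3 → ℤ} (hk : k ≠ 0)
    (hwin : psq (sideLength ρ N) k ≤ M₀ ^ 2 * (ρ * (scatteringLength v).toReal)) :
    0 < max (ρ * (scatteringLength v).toReal) (psq (sideLength ρ N) k) ∧
      max (ρ * (scatteringLength v).toReal) (psq (sideLength ρ N) k) ≤
        max 1 (M₀ ^ 2) * (ρ * (scatteringLength v).toReal) := by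
  have hp := UvThomsonFlow.psq_pos (sideLength_pos hρ hN).ne' hk
  have ha : 0 ≤ ρ * (scatteringLength v).toReal := mul_nonneg hρ.le ENNReal.toReal_nonneg
  refine ⟨lt_max_of_lt_right hp, max_le ?_ ?_⟩
  · exact le_mul_of_one_le_left ha (le_max_left _ _)
  · exact hwin.trans (mul_le_mul_of_nonneg_right (le_max_right _ _) ha)

/-- **Certified trivial regime inside the window**: `|t| ≥ max(1,M₀²)ρa/C` (the floor
`t⟨∑cos⟩ ≥ −|t|N` plus `E₀ ≤ E_Ψ`, `Negative.ineq_of_large_t`); together with `t = 0`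
(`Negative.ineq_zero`) this pins the open remainder of S1 to `0 < |t| < max(1,M₀²)ρa/C`. [folklore] -/
theorem ineq_of_window_large_t (v : ℝ → ℝ≥0∞) {C : ℝ} (hC : 0 < C) {M₀ ρ : ℝ} (hρ : 0 < ρ)
    {N : ℕ} (hN : 0 < N) {k : Fin 3 → ℤ} (hk : k ≠ 0)
    (hwin : psq (sideLength ρ N) k ≤ M₀ ^ 2 * (ρ * (scatteringLength v).toReal)) {t : ℝ}
    (ht : max 1 (M₀ ^ 2) * (ρ * (scatteringLength v).toReal) / C ≤ |t|)
    (Ψ : PeriodicTrialState N (sideLength ρ N)) (hΨ : periodicEnergy v Ψ ≠ ⊤) :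
    Ineq v C ρ N k t Ψ := by
  obtain ⟨hM, hle⟩ := max_window_bounds hρ hN hk hwin
  exact ineq_of_large_t v hC ρ k Ψ hΨ hM ((div_le_div_of_nonneg_right hle hC.le).trans ht)

/-! ## §5  Dictionary: S1 on the window ⟺ the all-states compressibility bound -/

/-- **Compressibility form ⇒ the inner inequality.** If a finite-energy state in the window obeys
`⟨∑cos⟩_Ψ² ≤ 4 (C′N/(ρa)) (E_Ψ − E₀)` (static response `χ ≤ C′N/(ρa)`), then `Ineq` holds for it at
every `t` with `C = C′·max(1,M₀²)` (`Negative.forall_ineq_iff_discriminant`). [folklore] -/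
theorem ineq_of_compressibility {v : ℝ → ℝ≥0∞} {C' M₀ ρ : ℝ} (hC' : 0 < C') (hρ : 0 < ρ) {N : ℕ}
    (hN : 0 < N) {k : Fin 3 → ℤ} (hk : k ≠ 0)
    (hwin : psq (sideLength ρ N) k ≤ M₀ ^ 2 * (ρ * (scatteringLength v).toReal))
    (Ψ : PeriodicTrialState N (sideLength ρ N)) (hΨ : periodicEnergy v Ψ ≠ ⊤)
    (hχ : cosMean (sideLength ρ N) k Ψ ^ 2 ≤
        4 * (C' * N / (ρ * (scatteringLength v).toReal)) *
          ((periodicEnergy v Ψ).toReal - (periodicGroundStateEnergy v N (sideLength ρ N)).toReal))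
    (t : ℝ) : Ineq v (C' * max 1 (M₀ ^ 2)) ρ N k t Ψ := by
  obtain ⟨hM, hle⟩ := max_window_bounds hρ hN hk hwin
  have ha : 0 < ρ * (scatteringLength v).toReal :=
    mul_pos hρ (scatteringLength_toReal_pos_of_window hρ hN hk hwin)
  have hC : 0 < C' * max 1 (M₀ ^ 2) := mul_pos hC' (lt_of_lt_of_le one_pos (le_max_left _ _))
  have hD : 0 ≤ (periodicEnergy v Ψ).toReal
      - (periodicGroundStateEnergy v N (sideLength ρ N)).toReal :=
    sub_nonneg.mpr (ENNReal.toReal_mono hΨ (periodicGroundStateEnergy_le v Ψ))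
  have hNR : (0 : ℝ) < N := by exact_mod_cast hN
  have hcoef : C' * N / (ρ * (scatteringLength v).toReal) ≤
      C' * max 1 (M₀ ^ 2) * N / max (ρ * (scatteringLength v).toReal) (psq (sideLength ρ N) k) := by
    rw [div_le_div_iff₀ ha hM]
    calc C' * N * max (ρ * (scatteringLength v).toReal) (psq (sideLength ρ N) k)
        ≤ C' * N * (max 1 (M₀ ^ 2) * (ρ * (scatteringLength v).toReal)) :=
          mul_le_mul_of_nonneg_left hle (by positivity)
      _ = C' * max 1 (M₀ ^ 2) * N * (ρ * (scatteringLength v).toReal) := by ring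
  refine (forall_ineq_iff_discriminant v k Ψ hC hN hM).mpr ?_ t
  exact hχ.trans (mul_le_mul_of_nonneg_right (mul_le_mul_of_nonneg_left hcoef (by norm_num)) hD)

/-- **The inner inequality ⇒ compressibility form.** Conversely, `∀ t, Ineq v C …` for a
finite-energy state in the window gives `⟨∑cos⟩_Ψ² ≤ 4 (CN/(ρa)) (E_Ψ − E₀)` (as `max ≥ ρa > 0`).
[folklore] -/
theorem compressibility_of_forall_ineq {v : ℝ → ℝ≥0∞} {C M₀ ρ : ℝ} (hC : 0 < C) (hρ : 0 < ρ)
    {N : ℕ} (hN : 0 < N) {k : Fin 3 → ℤ} (hk : k ≠ 0)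
    (hwin : psq (sideLength ρ N) k ≤ M₀ ^ 2 * (ρ * (scatteringLength v).toReal))
    (Ψ : PeriodicTrialState N (sideLength ρ N)) (hΨ : periodicEnergy v Ψ ≠ ⊤)
    (h : ∀ t : ℝ, Ineq v C ρ N k t Ψ) :
    cosMean (sideLength ρ N) k Ψ ^ 2 ≤
      4 * (C * N / (ρ * (scatteringLength v).toReal)) *
        ((periodicEnergy v Ψ).toReal - (periodicGroundStateEnergy v N (sideLength ρ N)).toReal) := by
  have hM := (max_window_bounds hρ hN hk hwin).1
  have ha : 0 < ρ * (scatteringLength v).toReal :=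
    mul_pos hρ (scatteringLength_toReal_pos_of_window hρ hN hk hwin)
  have hD : 0 ≤ (periodicEnergy v Ψ).toReal
      - (periodicGroundStateEnergy v N (sideLength ρ N)).toReal :=
    sub_nonneg.mpr (ENNReal.toReal_mono hΨ (periodicGroundStateEnergy_le v Ψ))
  have hNR : (0 : ℝ) < N := by exact_mod_cast hN
  have h1 := (forall_ineq_iff_discriminant v k Ψ hC hN hM).mp h
  have hcoef : C * N / max (ρ * (scatteringLength v).toReal) (psq (sideLength ρ N) k) ≤
      C * N / (ρ * (scatteringLength v).toReal) :=
    div_le_div_of_nonneg_left (by positivity) ha (le_max_left _ _)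
  exact h1.trans (mul_le_mul_of_nonneg_right (mul_le_mul_of_nonneg_left hcoef (by norm_num)) hD)

/-- **S1 from its compressibility form** (constants `C = C′·max(1,M₀²)`): the infrared half of
the crux IS the all-states bound `χ_N(p) ≤ C′N/(ρa)` on `|p| ≤ M₀√(ρa)`, uniformly in `N ≥ 1` along
`L = (N/ρ)^{1/3}` — the compressibility sum-rule regime of the dilute Bose gas (Bogoliubov:
`χ = N/(2(p² + 16πρa))`). [folklore] -/
theorem infraredHalf_of_compressibility
    (h : ∀ v : ℝ → ℝ≥0∞, IsRepulsiveFiniteRange v → ∀ M₀ : ℝ, 0 < M₀ →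
      ∃ ρ₀ : ℝ, 0 < ρ₀ ∧ ∃ C' : ℝ, 0 < C' ∧
        ∀ ρ : ℝ, 0 < ρ → ρ < ρ₀ → ∀ N : ℕ, 0 < N → ∀ k : Fin 3 → ℤ, k ≠ 0 →
          psq (sideLength ρ N) k ≤ M₀ ^ 2 * (ρ * (scatteringLength v).toReal) →
          ∀ Ψ : PeriodicTrialState N (sideLength ρ N), periodicEnergy v Ψ ≠ ⊤ →
            cosMean (sideLength ρ N) k Ψ ^ 2 ≤
              4 * (C' * N / (ρ * (scatteringLength v).toReal)) *
                ((periodicEnergy v Ψ).toReal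
                  - (periodicGroundStateEnergy v N (sideLength ρ N)).toReal)) :
    ∀ v : ℝ → ℝ≥0∞, IsRepulsiveFiniteRange v → ∀ M₀ : ℝ, 0 < M₀ →
      ∃ ρ₀ : ℝ, 0 < ρ₀ ∧ ∃ C : ℝ, 0 < C ∧
        ∀ ρ : ℝ, 0 < ρ → ρ < ρ₀ → ∀ N : ℕ, 0 < N → ∀ k : Fin 3 → ℤ, k ≠ 0 →
          psq (sideLength ρ N) k ≤ M₀ ^ 2 * (ρ * (scatteringLength v).toReal) →
          ∀ t : ℝ, ∀ Ψ : PeriodicTrialState N (sideLength ρ N), periodicEnergy v Ψ ≠ ⊤ →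
            Ineq v C ρ N k t Ψ := by
  intro v hv M₀ hM₀
  obtain ⟨ρ₀, hρ₀, C', hC', hB⟩ := h v hv M₀ hM₀
  refine ⟨ρ₀, hρ₀, C' * max 1 (M₀ ^ 2), mul_pos hC' (lt_of_lt_of_le one_pos (le_max_left _ _)), ?_⟩
  intro ρ hρ hρlt N hN k hk hwin t Ψ hΨ
  exact ineq_of_compressibility hC' hρ hN hk hwin Ψ hΨ (hB ρ hρ hρlt N hN k hk hwin Ψ hΨ) t

end Summit.AtomisticToContinuum.BoseEinsteinCondensation.Cruxes.StaticResponseBound.UvThomsonForceWave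

end
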